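import Literature.AlgebraicGeometry.Resolution.TameCyclicEigenparameters
import HarnessLib

/-!
# Joint eigen-parameters for a commuting family of tame automorphisms ([CoP1] Prop. 6.2 (2))

Topic: `Literature/AlgebraicGeometry/Resolution`. PROOF side of `CossartPiltant2019ReductionP`
(`ArithmeticalThreefoldsLocal.lean`), input (C4), toric route, abelian variant
(`TameAbelianToricDescent.lean`). [CoP1] Prop. 6.2 (2): for the tame part `H = Gⁱ/Gʳ` of the
inertia group "the action is diagonal on `R̂ʳ`" — an ABELIAN group of prime-to-`p` order acting
on a regular local ring through residually trivial automorphisms admits a regular system of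
parameters of JOINT eigenvectors. `TameCyclicEigenparameters.lean` proved the cyclic case
algebraically (twisted Reynolds operators on the cotangent space); this file proves the case of
a commuting family `τ₀, …, τ_{r-1}` with a common fixed root of unity `ζ`: the products of the
twisted Reynolds operators of the `τᵢ` commute and project onto joint eigenvectors, which span
`𝔪_B`; a basis of `𝔪/𝔪²` among them is a regular system of parameters.

* `exists_joint_eigen_regularParameters_of_commuting` — PROVED.

Everything is PROVED; no named facts are introduced.

## Sources

* V. Cossart, O. Piltant, *Resolution of singularities of threefolds in positive characteristic.
  I*, J. Algebra 320 (2008) 1051–1082: Prop. 6.2 (2) with (28)–(30) (HAL hal-00139124, p. 19).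
  [CossartPiltant2008]
-/

noncomputable section

namespace Literature.AlgebraicGeometry.Resolution

universe u

open IsLocalRing

section JointEigen

variable {B : Type u} [CommRing B] [IsRegularLocalRing B]

/-- **Joint eigen-parameters for a commuting family of tame, residually compatible
automorphisms** ([CoP1] Prop. 6.2 (2), (28)–(30): "the action is diagonal"). Let `B` be a
regular local ring of dimension `d`, `ℓ ∈ B^×`, `ζ ∈ B` with `ζ^ℓ = 1` and `ζ^k - 1 ∈ B^×` for
`0 < k < ℓ`, and `τ₀, …, τ_{r-1}` pairwise commuting automorphisms of `B` with `τᵢ^ℓ = 1` and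
`τᵢ ζ = ζ`. Then `𝔪_B` has a regular system of parameters `x₁, …, x_d` of JOINT eigenvectors:
`τᵢ xⱼ = ζ^{sᵢⱼ} xⱼ` with `sᵢⱼ < ℓ`. [cite: CossartPiltant2008, Prop. 6.2 (2) (28)–(30) (HAL p. 19)] -/
theorem exists_joint_eigen_regularParameters_of_commuting (τ : ℕ → B ≃+* B) (r : ℕ) {ℓ : ℕ}
    (hℓ0 : ℓ ≠ 0) (hτℓ : ∀ i < r, τ i ^ ℓ = 1)
    (hcomm : ∀ i < r, ∀ i' < r, ∀ b : B, τ i (τ i' b) = τ i' (τ i b))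
    (hℓu : IsUnit ((ℓ : B))) (ζ : B) (hτζ : ∀ i < r, τ i ζ = ζ) (hζℓ : ζ ^ ℓ = 1)
    (hζu : ∀ k : ℕ, 0 < k → k < ℓ → IsUnit (ζ ^ k - 1))
    {d : ℕ} (hdim : ringKrullDim B = (d : ℕ)) :
    ∃ (x : Fin d → B) (s : ℕ → Fin d → ℕ), Ideal.span (Set.range x) = maximalIdeal B ∧
      ∀ i < r, ∀ j, s i j < ℓ ∧ τ i (x j) = ζ ^ (s i j) * x j := by
  classical
  have hℓpos : 0 < ℓ := Nat.pos_of_ne_zero hℓ0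
  -- `ζ' = ζ⁻¹`
  set ζ' : B := ζ ^ (ℓ - 1) with hζ'def
  have hζζ' : ζ * ζ' = 1 := by
    rw [hζ'def, ← pow_succ', Nat.sub_add_cancel hℓpos, hζℓ]
  have hζ'ζ : ζ' * ζ = 1 := by rw [mul_comm, hζζ']
  have hζ'ℓ : ζ' ^ ℓ = 1 := by rw [hζ'def, ← pow_mul, mul_comm, pow_mul, hζℓ, one_pow]
  have hτiζ : ∀ i < r, ∀ (n m : ℕ), (τ i ^ n) (ζ ^ m) = ζ ^ m := by
    intro i hi n m
    induction n with
    | zero => rfl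
    | succ n ih => rw [pow_succ', RingAut.mul_apply, ih, map_pow, hτζ i hi]
  have hτiζ' : ∀ i < r, ∀ (n m : ℕ), (τ i ^ n) (ζ' ^ m) = ζ' ^ m := by
    intro i hi n m
    rw [hζ'def, ← pow_mul, hτiζ i hi]
  have hτℓb : ∀ i < r, ∀ b : B, (τ i ^ ℓ) b = b := fun i hi b => by rw [hτℓ i hi]; rfl
  -- automorphisms preserve the maximal ideal
  have hτm : ∀ i (n : ℕ) (b : B), b ∈ maximalIdeal B → (τ i ^ n) b ∈ maximalIdeal B := by
    intro i n b hb
    rw [IsLocalRing.mem_maximalIdeal, mem_nonunits_iff] at hb ⊢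
    intro hu
    apply hb
    have := hu.map (τ i ^ n).symm
    rwa [RingEquiv.symm_apply_apply] at this
  -- powers of commuting automorphisms commute
  have hcommpow : ∀ i < r, ∀ i' < r, ∀ (n : ℕ) (b : B), τ i ((τ i' ^ n) b) = (τ i' ^ n) (τ i b) := by
    intro i hi i' hi' n
    induction n with
    | zero => intro b; rfl
    | succ n ih => intro b; rw [pow_succ', RingAut.mul_apply, RingAut.mul_apply, hcomm i hi i' hi', ih]
  /- the twisted Reynolds operators of `τ i` -/
  let P : ℕ → ℕ → B → B := fun i k b => ∑ n ∈ Finset.range ℓ, ζ' ^ (k * n) * (τ i ^ n) b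
  have hPdef : ∀ i k b, P i k b = ∑ n ∈ Finset.range ℓ, ζ' ^ (k * n) * (τ i ^ n) b :=
    fun _ _ _ => rfl
  -- `τ i ∘ P i k = ζ^k P i k`
  have hτP : ∀ i < r, ∀ k b, τ i (P i k b) = ζ ^ k * P i k b := by
    intro i hi k b
    rw [hPdef, map_sum, Finset.mul_sum]
    let f : ℕ → B := fun n => (ζ ^ k * ζ' ^ (k * n)) * (τ i ^ n) b
    have hf : ∀ n, τ i (ζ' ^ (k * n) * (τ i ^ n) b) = f (n + 1) := by
      intro n
      have hz : τ i (ζ' ^ (k * n)) = ζ' ^ (k * n) := by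
        have := hτiζ' i hi 1 (k * n); rwa [pow_one] at this
      rw [map_mul, hz, show τ i ((τ i ^ n) b) = (τ i ^ (n + 1)) b by
        rw [pow_succ', RingAut.mul_apply]]
      change _ = (ζ ^ k * ζ' ^ (k * (n + 1))) * (τ i ^ (n + 1)) b
      congr 1
      rw [mul_add, mul_one, pow_add, ← mul_assoc, mul_comm (ζ ^ k), mul_assoc, ← mul_pow, hζζ',
        one_pow, mul_one]
    have hg : ∀ n, ζ ^ k * (ζ' ^ (k * n) * (τ i ^ n) b) = f n := by
      intro n
      change _ = (ζ ^ k * ζ' ^ (k * n)) * (τ i ^ n) b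
      rw [mul_assoc]
    simp only [hf, hg]
    have hfℓ : f ℓ = f 0 := by
      change (ζ ^ k * ζ' ^ (k * ℓ)) * (τ i ^ ℓ) b = (ζ ^ k * ζ' ^ (k * 0)) * (τ i ^ 0) b
      rw [mul_comm k ℓ, pow_mul, hζ'ℓ, one_pow, mul_zero, pow_zero, hτℓb i hi, pow_zero,
        RingAut.one_apply]
    obtain ⟨m, hm⟩ : ∃ m, ℓ = m + 1 := ⟨ℓ - 1, by omega⟩
    rw [hm, Finset.sum_range_succ' f, Finset.sum_range_succ (fun x => f (x + 1)), ← hm, hfℓ]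
  -- `P i k` commutes with `τ i'` and preserves `τ i'`-eigenvectors
  have hPeigen : ∀ i < r, ∀ i' < r, ∀ (k k' : ℕ) (b : B), τ i' b = ζ ^ k' * b →
      τ i' (P i k b) = ζ ^ k' * P i k b := by
    intro i hi i' hi' k k' b hb
    rw [hPdef, map_sum, Finset.mul_sum]
    refine Finset.sum_congr rfl fun n _ => ?_
    have hz : τ i' (ζ' ^ (k * n)) = ζ' ^ (k * n) := by
      have := hτiζ' i' hi' 1 (k * n); rwa [pow_one] at this
    rw [map_mul, hz, hcommpow i' hi' i hi, hb, map_mul, map_pow]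
    have hz2 : (τ i ^ n) ζ = ζ := by have := hτiζ i hi n 1; rwa [pow_one] at this
    rw [hz2]; ring
  -- the character sums and `∑_k P i k = ℓ · id`
  have hchar : ∀ k, 0 < k → k < ℓ → (∑ n ∈ Finset.range ℓ, ζ' ^ (k * n)) = 0 := by
    intro k hk hkℓ
    have h1 : (∑ n ∈ Finset.range ℓ, (ζ' ^ k) ^ n) * (ζ' ^ k - 1) = 0 := by
      rw [geom_sum_mul, ← pow_mul, mul_comm, pow_mul, hζ'ℓ, one_pow, sub_self]
    have hu : IsUnit (ζ' ^ k - 1) := by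
      have h2 : ζ' ^ k - 1 = -(ζ' ^ k * (ζ ^ k - 1)) := by
        rw [mul_sub, mul_one, ← mul_pow, hζ'ζ, one_pow]; ring
      rw [h2]
      exact ((IsUnit.of_mul_eq_one ζ hζ'ζ).pow k |>.mul (hζu k hk hkℓ)).neg
    have h3 : (∑ n ∈ Finset.range ℓ, (ζ' ^ k) ^ n) = 0 := (hu.mul_left_eq_zero).mp h1
    rw [← h3]
    exact Finset.sum_congr rfl fun n _ => by rw [pow_mul]
  have hsumP : ∀ i < r, ∀ b, (∑ k ∈ Finset.range ℓ, P i k b) = (ℓ : B) * b := by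
    intro i hi b
    simp only [hPdef]
    rw [Finset.sum_comm]
    have h1 : ∀ n ∈ Finset.range ℓ,
        (∑ k ∈ Finset.range ℓ, ζ' ^ (k * n) * (τ i ^ n) b) =
          (∑ k ∈ Finset.range ℓ, ζ' ^ (n * k)) * (τ i ^ n) b := by
      intro n _
      rw [Finset.sum_mul]
      exact Finset.sum_congr rfl fun k _ => by rw [mul_comm k n]
    rw [Finset.sum_congr rfl h1]
    obtain ⟨m, hm⟩ : ∃ m, ℓ = m + 1 := ⟨ℓ - 1, by omega⟩
    rw [hm, Finset.sum_range_succ' (fun n => (∑ k ∈ Finset.range (m + 1), ζ' ^ (n * k)) * (τ i ^ n) b),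
      ← hm]
    have h2 : ∀ n ∈ Finset.range m,
        (∑ k ∈ Finset.range ℓ, ζ' ^ ((n + 1) * k)) * (τ i ^ (n + 1)) b = 0 := by
      intro n hn
      rw [hchar (n + 1) (Nat.succ_pos n) (by rw [hm]; exact Nat.succ_lt_succ (Finset.mem_range.mp hn)),
        zero_mul]
    rw [Finset.sum_eq_zero h2, zero_add]
    simp
  have hPm : ∀ i k b, b ∈ maximalIdeal B → P i k b ∈ maximalIdeal B := by
    intro i k b hb
    rw [hPdef]
    exact Ideal.sum_mem _ fun n _ => Ideal.mul_mem_left _ _ (hτm i n b hb)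
  obtain ⟨u, hu⟩ := hℓu.exists_left_inv
  /- joint eigenvectors for `τ₀, …, τ_{j-1}` span `𝔪_B`, by induction on `j` -/
  let E : ℕ → Set (maximalIdeal B) := fun j =>
    {e | ∀ i < j, ∃ k, k < ℓ ∧ τ i (e : B) = ζ ^ k * (e : B)}
  have hEspan : ∀ j, j ≤ r → Submodule.span B (E j) = ⊤ := by
    intro j
    induction j with
    | zero =>
      intro _
      rw [eq_top_iff]
      rintro y -
      exact Submodule.subset_span (fun i hi => absurd hi (Nat.not_lt_zero i))
    | succ j ih =>
      intro hj
      have hj' : j < r := Nat.lt_of_succ_le hj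
      rw [eq_top_iff, ← ih hj'.le]
      refine Submodule.span_le.mpr fun e he => ?_
      -- `e = ∑_k u • P j k e`, each term a joint eigenvector for `τ₀, …, τ_j`
      have hy : (e : maximalIdeal B) =
          ∑ k ∈ Finset.range ℓ, u • (⟨P j k e, hPm j k e e.2⟩ : maximalIdeal B) := by
        apply Subtype.ext
        rw [AddSubmonoidClass.coe_finsetSum]
        simp only [SetLike.val_smul, smul_eq_mul]
        rw [← Finset.mul_sum, hsumP j hj', ← mul_assoc, hu, one_mul]
      rw [SetLike.mem_coe, hy]
      refine Submodule.sum_mem _ fun k hk => Submodule.smul_mem _ _ (Submodule.subset_span ?_)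
      intro i hi
      rcases Nat.lt_succ_iff_lt_or_eq.mp hi with hi | rfl
      · obtain ⟨k', hk', hek'⟩ := he i hi
        exact ⟨k', hk', hPeigen j hj' i (hi.trans hj') k k' e hek'⟩
      · exact ⟨k, Finset.mem_range.mp hk, hτP i hj' k e⟩
  /- extract a regular system of parameters from `E r` -/
  set κ := ResidueField B with hκ
  set V := CotangentSpace B with hV
  have hspanκ : Submodule.span κ ((maximalIdeal B).toCotangent '' E r) = ⊤ :=
    IsLocalRing.CotangentSpace.span_image_eq_top_iff.mpr (hEspan r le_rfl)
  let w : E r → V := fun e => (maximalIdeal B).toCotangent (e : maximalIdeal B)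
  have hwrange : Set.range w = (maximalIdeal B).toCotangent '' E r := by
    ext v
    constructor
    · rintro ⟨e, rfl⟩; exact ⟨e, e.2, rfl⟩
    · rintro ⟨e, he, rfl⟩; exact ⟨⟨e, he⟩, rfl⟩
  obtain ⟨ι, a, -, hspan_eq, hli⟩ := exists_linearIndependent' (K := κ) w
  have hspanι : Submodule.span κ (Set.range (w ∘ a)) = ⊤ := by
    rw [hspan_eq, hwrange, hspanκ]
  haveI : Finite ι := hli.finite
  letI : Fintype ι := Fintype.ofFinite ι
  let bas : Module.Basis ι κ V := Module.Basis.mk hli (le_of_eq hspanι.symm)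
  have hfinrank : Module.finrank κ V = d := by
    have h1 := (IsRegularLocalRing.iff_finrank_cotangentSpace B).mp inferInstance
    rw [hdim] at h1
    exact_mod_cast h1
  have hcard : Fintype.card ι = d := by
    rw [← hfinrank, Module.finrank_eq_card_basis bas]
  let eqv : ι ≃ Fin d := Fintype.equivFinOfCardEq hcard
  let e : Fin d → maximalIdeal B := fun j => ((a (eqv.symm j)) : maximalIdeal B)
  have heE : ∀ j, (e j) ∈ E r := fun j => (a (eqv.symm j)).2
  have hespan : Submodule.span B (Set.range e) = ⊤ := by
    apply IsLocalRing.CotangentSpace.span_image_eq_top_iff.mp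
    rw [← Set.range_comp]
    have h1 : (maximalIdeal B).toCotangent ∘ e = (w ∘ a) ∘ eqv.symm := by
      ext j; rfl
    rw [h1, Set.range_comp, eqv.symm.range_eq_univ, Set.image_univ, hspanι]
  -- the characters: for `i < r` chosen from `E r`, for `i ≥ r` anything
  have hchoose : ∀ i j, ∃ k, i < r → k < ℓ ∧ τ i (e j : B) = ζ ^ k * (e j : B) := by
    intro i j
    by_cases hi : i < r
    · obtain ⟨k, hk, hek⟩ := heE j i hi
      exact ⟨k, fun _ => ⟨hk, hek⟩⟩
    · exact ⟨0, fun h => absurd h hi⟩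
  choose s hs using hchoose
  refine ⟨fun j => (e j : B), s, ?_, fun i hi j => hs i j hi⟩
  have h1 : Set.range (fun j => (e j : B)) = (maximalIdeal B).subtype '' Set.range e := by
    rw [← Set.range_comp]; rfl
  rw [h1]
  change Submodule.span B _ = _
  rw [← Submodule.map_span, hespan, Submodule.map_top, Submodule.range_subtype]

end JointEigen

end Literature.AlgebraicGeometry.Resolution

end
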